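import Literature.Barriers.CriticalPhenomena.SupercriticalSAWSpaceFillingTilesDeep
import Literature.Barriers.CriticalPhenomena.SupercriticalSAWSpaceFillingRefutation
import Literature.Probability.LatticeModels.LatticeAnimals
import HarnessLib

/-!
# Supercritical SAW (Duminil-Copin–Kozma–Yadin 2014), Theorem 6 for the disk via odd tiles:
# the dichotomy — a non-clear deep tile next to a large clear connected family, or an annular walk

Tile form of the first half of the printed proof of Theorem 6 of H. Duminil-Copin, G. Kozma,
A. Yadin, *Supercritical self-avoiding walks are space-filling*, Ann. IHP Probab. Stat. 50
(2014), §3 ("Let `S` be a connected component of `Ω_δ ∖ Γ_δ^{6m}` of cardinality larger than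
`s` … consider the maximal family `F` of connected boxes covering `S` and not intersecting
`γ_δ` … the box-distance between the union of boxes and `γ_δ` is 1"), for `Ω = 𝔻` and the odd
tiles of `SAWTiles.lean`, with clearance measured in `ℓ¹` from tile centres (`IsClearTile`):

* `exists_clear_family_or_annulus` — from `HasLargeHole ξ s γ` with
  `ξ ≥ ρ + 2K + 2h + 1`, `δ ≤ 1/K²`, `K ≥ Rd + h + 1`: EITHER there are a connected family `𝒞` of
  deep tiles, all clear of `γ` with radius `ρ`, with `(2(K+h)+1)² |𝒞| > s`, and a deep tile
  `t' ∉ 𝒞` NOT clear of `γ` adjacent to a tile of `𝒞` (the printed case), OR every deep tile is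
  clear of `γ` (the annular case the print omits; then the origin tile is deep).
  Proof: the hole tiles of the sites of the hole (`holeTile`, `…TilesDeep.lean`) are deep,
  clear and form a connected family; take the component `𝒞` of their family in the graph of
  clear deep tiles; if no non-clear deep tile is adjacent to it, it is closed under deep
  neighbours, hence is the whole family of deep tiles (`forall_isDeepTile_of_closed`).
* `famT`, `card_famT_le` — the summation index of the Peierls sum (connected families of `N`
  deep tiles through a given tile, at most `25^{N-1}` of them, `card_connectedFamily_le`).
-/

noncomputable section

open Finset Literature.Probability.LatticeModels Literature.Probability.Percolation
  Literature.Probability.RandomPlanarGeometry.SAW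

namespace Literature.Barriers.CriticalPhenomena

namespace SupercriticalSAW

variable {m r : ℕ} {δ : ℝ} {u v : Site 2}

/-- Chains along adjacent-or-equal steps inside a set give chains of adjacent steps inside it.
[folklore] -/
theorem reflTransGen_adj_of_adj_or_eq {T : Finset (Site 2)} {a b : Site 2}
    (h : Relation.ReflTransGen (fun x y => (x = y ∨ (zdGraph 2).Adj x y) ∧ x ∈ T ∧ y ∈ T) a b) :
    Relation.ReflTransGen (fun x y => (zdGraph 2).Adj x y ∧ x ∈ T ∧ y ∈ T) a b := by
  induction h with
  | refl => exact Relation.ReflTransGen.refl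
  | @tail c d _ hcd ih =>
    rcases hcd.1 with rfl | hadj
    · exact ih
    · exact ih.tail ⟨hadj, hcd.2.1, hcd.2.2⟩

/-- **The dichotomy behind the Peierls sum (tile form).** See the module docstring.
[cite: DuminilCopinKozmaYadin2014, §3 (proof of Theorem 6: the maximal connected family of untouched boxes covering S)] -/
theorem exists_clear_family_or_annulus (hδ : 0 < δ) {Rd K : ℕ} {ρ : ℤ}
    (hK : Rd + OddTile.hw m r + 1 ≤ K) (hK2 : 2 ≤ K) (hδ' : δ ≤ 1 / (K : ℝ) ^ 2)
    (hu : u ∈ meshDomain unitDisk δ) {ξ s : ℝ} (hs : 0 ≤ s)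
    (hξ : ((ρ + 2 * K + 2 * OddTile.hw m r + 1 : ℤ) : ℝ) ≤ ξ)
    {γ : DomainSAW unitDisk δ u v} (h : HasLargeHole ξ s γ) :
    (∃ 𝒞 : Finset (Site 2), 𝒞 ⊆ deepTiles δ m r Rd ∧ IsGraphConnected (zdGraph 2) 𝒞 ∧
        (∀ τ ∈ 𝒞, IsClearTile m r γ.walk.support ρ τ) ∧
        s < ((2 * (K + OddTile.hw m r) + 1) ^ 2 : ℕ) * (𝒞.card : ℝ) ∧
        ∃ t', t' ∉ 𝒞 ∧ IsDeepTile δ m r Rd t' ∧ ¬IsClearTile m r γ.walk.support ρ t' ∧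
          ∃ t ∈ 𝒞, (zdGraph 2).Adj t t') ∨
      ((∀ τ, IsDeepTile δ m r Rd τ → IsClearTile m r γ.walk.support ρ τ) ∧ IsDeepTile δ m r Rd 0) := by
  classical
  set l := γ.walk.support with hl
  have hlD : ∀ g ∈ l, g ∈ meshDomain unitDisk δ := walk_support_subset_meshDomain γ.walk hu
  obtain ⟨S, hScard, hSD, hSfar, hSconn⟩ := exists_finset_of_hasLargeHole hδ h
  -- the hole tiles
  have hdeep : ∀ w ∈ S, IsDeepTile δ m r Rd (holeTile m r K w) := fun w hw =>
    isDeepTile_holeTile hK hK2 hδ hδ' (hSD w hw)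
  have hclear : ∀ w ∈ S, IsClearTile m r l ρ (holeTile m r K w) := fun w hw =>
    isClearTile_holeTile (hSD w hw) hlD fun g hg => by
      have := hSfar w hw g hg
      exact_mod_cast hξ.trans this
  have hSne : S.Nonempty := Finset.card_pos.1 (by
    have : (0 : ℝ) < S.card := hs.trans_lt hScard
    exact_mod_cast this)
  obtain ⟨w₀, hw₀⟩ := hSne
  set τ₀ := holeTile m r K w₀ with hτ₀
  -- good tiles and the component of `τ₀`
  let Good : Site 2 → Prop := fun τ => IsDeepTile δ m r Rd τ ∧ IsClearTile m r l ρ τ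
  let Rch : Site 2 → Prop := fun τ => Relation.ReflTransGen (fun x y => (zdGraph 2).Adj x y ∧ Good x ∧ Good y) τ₀ τ
  set 𝒞 : Finset (Site 2) := (deepTiles δ m r Rd).filter fun τ => IsClearTile m r l ρ τ ∧ Rch τ with h𝒞
  have hmem𝒞 : ∀ {τ}, τ ∈ 𝒞 ↔ Good τ ∧ Rch τ := by
    intro τ; rw [h𝒞, Finset.mem_filter, mem_deepTiles hδ]; tauto
  have hτ₀good : Good τ₀ := ⟨hdeep w₀ hw₀, hclear w₀ hw₀⟩
  have hτ₀ : τ₀ ∈ 𝒞 := hmem𝒞.2 ⟨hτ₀good, Relation.ReflTransGen.refl⟩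
  -- the hole tiles lie in `𝒞`
  have hT𝒞 : ∀ w ∈ S, holeTile m r K w ∈ 𝒞 := by
    intro w hw
    refine hmem𝒞.2 ⟨⟨hdeep w hw, hclear w hw⟩, ?_⟩
    -- along the chain the hole tiles are equal or adjacent, and good
    have key : ∀ d, Relation.ReflTransGen (familyStep S) w₀ d → Rch (holeTile m r K d) := by
      intro d hd
      induction hd with
      | refl => exact Relation.ReflTransGen.refl
      | @tail c d _ hcd ih =>
        rcases holeTile_adj_or_eq (m := m) (r := r) K hcd.1 with he | hadj
        · rw [← he]; exact ih
        · exact ih.tail ⟨hadj, ⟨hdeep c hcd.2.1, hclear c hcd.2.1⟩, ⟨hdeep d hcd.2.2, hclear d hcd.2.2⟩⟩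
    exact key w (hSconn w₀ hw₀ w hw)
  -- `𝒞` is connected
  have h𝒞conn : IsGraphConnected (zdGraph 2) 𝒞 := by
    rw [isGraphConnected_iff_reflTransGen hτ₀]
    intro τ hτ
    have hr := (hmem𝒞.1 hτ).2
    -- every vertex along the chain is good and reachable, hence in `𝒞`
    clear hτ
    induction hr with
    | refl => exact Relation.ReflTransGen.refl
    | @tail c d hc hcd ih =>
      refine ih.tail ⟨hcd.1, hmem𝒞.2 ⟨hcd.2.1, hc⟩, hmem𝒞.2 ⟨hcd.2.2, hc.tail hcd⟩⟩
  -- sizes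
  have hsize : s < ((2 * (K + OddTile.hw m r) + 1) ^ 2 : ℕ) * (𝒞.card : ℝ) := by
    have h1 := card_le_mul_card_image_holeTile (m := m) (r := r) K S
    have h2 : (S.image (holeTile m r K)).card ≤ 𝒞.card :=
      Finset.card_le_card fun τ hτ => by
        obtain ⟨w, hw, rfl⟩ := Finset.mem_image.1 hτ; exact hT𝒞 w hw
    have h3 : (S.card : ℝ) ≤ ((2 * (K + OddTile.hw m r) + 1) ^ 2 : ℕ) * (𝒞.card : ℝ) := by
      have := h1.trans (Nat.mul_le_mul_left _ h2); exact_mod_cast this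
    exact hScard.trans_le h3
  by_cases hmain : ∃ t', IsDeepTile δ m r Rd t' ∧ ¬IsClearTile m r l ρ t' ∧ ∃ t ∈ 𝒞, (zdGraph 2).Adj t t'
  · left
    obtain ⟨t', ht'deep, ht'ncl, t, ht, hadj⟩ := hmain
    refine ⟨𝒞, fun τ hτ => (mem_deepTiles hδ).2 (hmem𝒞.1 hτ).1.1, h𝒞conn, fun τ hτ => (hmem𝒞.1 hτ).1.2,
      hsize, t', fun h' => ht'ncl (hmem𝒞.1 h').1.2, ht'deep, ht'ncl, t, ht, hadj⟩
  · right
    push Not at hmain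
    have hcl : ∀ τ τ', τ ∈ 𝒞 → (zdGraph 2).Adj τ τ' → IsDeepTile δ m r Rd τ' → τ' ∈ 𝒞 := by
      intro τ τ' hτ hadj hτ'
      have hcl' : IsClearTile m r l ρ τ' := by
        by_contra hnot; exact hmain τ' hτ' hnot τ hτ hadj
      have hg := hmem𝒞.1 hτ
      exact hmem𝒞.2 ⟨⟨hτ', hcl'⟩, hg.2.tail ⟨hadj, hg.1, ⟨hτ', hcl'⟩⟩⟩
    have hall := forall_isDeepTile_of_closed (P := fun τ => τ ∈ 𝒞) hcl hτ₀ hτ₀good.1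
    exact ⟨fun τ hτ => (hmem𝒞.1 (hall τ hτ)).1.2, isDeepTile_zero hτ₀good.1⟩

/-! ### The summation index of the Peierls sum -/

/-- The connected families of `N` deep tiles containing the tile `τ`. [cite: DuminilCopinKozmaYadin2014, §3 (proof of Theorem 6: "the number of families of connected boxes of size K")] -/
def famT (δ : ℝ) (m r Rd : ℕ) (τ : Site 2) (N : ℕ) : Finset (Finset (Site 2)) :=
  ((deepTiles δ m r Rd).powerset).filter fun F => F.card = N ∧ τ ∈ F ∧ IsGraphConnected (zdGraph 2) F

/-- Membership in `famT`. [folklore] -/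
theorem mem_famT {Rd : ℕ} {τ : Site 2} {N : ℕ} {F : Finset (Site 2)} :
    F ∈ famT δ m r Rd τ N ↔ F ⊆ deepTiles δ m r Rd ∧ F.card = N ∧ τ ∈ F ∧ IsGraphConnected (zdGraph 2) F := by
  rw [famT, Finset.mem_filter, Finset.mem_powerset]

/-- **Counting connected families of tiles**: at most `25^{N-1}` connected families of `N`
tiles contain a given tile (lattice animals, `Δ = 4`). [cite: DuminilCopinKozmaYadin2014, §3 (proof of Theorem 6: "A_n ≤ λⁿ … Theorem (4.20) in [Grimmett]")] -/
theorem card_famT_le (Rd : ℕ) (τ : Site 2) (N : ℕ) : (famT δ m r Rd τ N).card ≤ 25 ^ (N - 1) := by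
  classical
  have hΔ : ∀ x : Site 2, ((zdGraph 2).neighborFinset x).card ≤ 4 := by
    intro x
    have hsub : (zdGraph 2).neighborFinset x ⊆
        (Finset.univ : Finset (Fin 2 × Bool)).image fun p => x + dirVec p.1 p.2 := by
      intro y hy
      rw [SimpleGraph.mem_neighborFinset] at hy
      rw [Finset.mem_image]
      obtain ⟨i, rfl | rfl⟩ := (zdGraph_adj_iff _ _).1 hy
      · exact ⟨(i, true), Finset.mem_univ _, by simp [dirVec]⟩
      · exact ⟨(i, false), Finset.mem_univ _, by rw [dirVec, add_assoc, ← Pi.single_add]; simp⟩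
    exact (Finset.card_le_card hsub).trans (Finset.card_image_le.trans (by simp))
  have h := card_connectedFamily_le (R := (zdGraph 2).Adj) (fun x y h => h.symm)
    (nbr := fun x => (zdGraph 2).neighborFinset x) (Δ := 4) hΔ
    (fun x y h => (SimpleGraph.mem_neighborFinset _ _ _).2 h) τ (N - 1) (famT δ m r Rd τ N) ?_
  · calc (famT δ m r Rd τ N).card ≤ (4 + 1) ^ (2 * (N - 1)) := h
      _ = 25 ^ (N - 1) := by rw [pow_mul]; norm_num
  · intro F hF
    rw [mem_famT] at hF
    obtain ⟨-, hcard, hτ, hconn⟩ := hF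
    exact ⟨hτ, by omega, (isGraphConnected_iff_reflTransGen hτ).1 hconn⟩

end SupercriticalSAW

end Literature.Barriers.CriticalPhenomena
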